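import Mathlib

/-!
# UnipotentESocLaw — g17 (hsemireg-alphabet-unipotent-1): the analytic part of
  THEOREM E_all | (E_soc):  (E_soc) ⇒ Ψ(W) ≥ 1 for every indecomposable finite-length W over k⟦z,w⟧ with zW ≠ 0.

Evidence file (Mathlib only, no project imports, no `sorry`). Nothing here is a statement about the
Hodge conjecture; it kernel-checks the integer inequalities of the memo `U-ESOC-unipotent1-g17.md` §3.

Dictionary (all integers): `t` = dim soc N (N = zW), `m` = μ(N), `s` = σ − t ≥ 0 (σ = dim soc W),
`R` = μ + σ − τ, `E` = e_N = dim End_R N with the hypothesis (E_soc)+(dual): 2E ≥ t(t+1), 2E ≥ m(m+1),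
`P` = the level-≥3 product term, `F` = the closed lower bound of Ψ derived in §3:
  F = 12E + 4 − 2t² − 2t − 2mt + s(12m − 2t − 2) + (2t+1)R + P.
-/

namespace UnipotentESocLaw

/-- The closed lower bound `F` of Ψ (memo §3, (F)). -/
def F (t m s R E P : ℤ) : ℤ :=
  12*E + 4 - 2*t^2 - 2*t - 2*m*t + s*(12*m - 2*t - 2) + (2*t+1)*R + P

/-- §3 identity (lvl12): level 1 + level 2 + 14μs, with σ = t+s and τ = m+σ−R, equals the R-linear form. -/
theorem level12_identity (t m s R : ℤ) :
    -2*(t+s)*(m + (t+s) - R) - (t+s) + ((t+s) - R)*(2*s - 1) + 14*m*s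
      = 12*m*(t+s) - 14*m*t - 2*(t+s)*t - 2*(t+s) + 2*R*t + R := by
  ring

/-- §3 identity: the R-linear form equals `F − 12E − 4 − P` in the variables (t, m, s, R). -/
theorem F_closed_form (t m s R E P : ℤ) :
    12*m*(t+s) - 14*m*t - 2*(t+s)*t - 2*(t+s) + 2*R*t + R + 12*E + 4 + P = F t m s R E P := by
  simp only [F]; ring

/-- Case I (s = 0): Ψ ≥ −2στ − σ + 12E + 4 with σ = t, τ = m + t − R. -/
theorem caseI (t m R E : ℤ) (ht : 1 ≤ t) (hm : 1 ≤ m) (hR : 0 ≤ R)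
    (hEt : t*(t+1) ≤ 2*E) (hEm : m*(m+1) ≤ 2*E) :
    0 < -2*t*(m + t - R) - t + 12*E + 4 := by
  by_cases h : m ≤ t
  · nlinarith
  · have h' : t < m := not_le.mp h
    nlinarith

/-- Case L = 1 (Y semisimple): Ψ ≥ 12E + 4 − 4mt − t + s(10m − 1). -/
theorem caseL1 (t m s E : ℤ) (ht : 1 ≤ t) (hm : 1 ≤ m) (hs : 0 ≤ s)
    (hEt : t*(t+1) ≤ 2*E) (hEm : m*(m+1) ≤ 2*E) :
    0 < 12*E + 4 - 4*m*t - t + s*(10*m - 1) := by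
  have h1 : 0 ≤ s*(10*m - 1) := by nlinarith
  by_cases h : m ≤ t
  · nlinarith
  · have h' : t < m := not_le.mp h
    nlinarith

/-- Cases II.a / III.a (12m ≥ 2t+2): the s-coefficient is ≥ 0. -/
theorem caseIIa (t m s R E P : ℤ) (ht : 1 ≤ t) (hm : 1 ≤ m) (hs : 0 ≤ s) (hR : 0 ≤ R) (hP : 0 ≤ P)
    (hbig : 2*t + 2 ≤ 12*m) (hEt : t*(t+1) ≤ 2*E) (hEm : m*(m+1) ≤ 2*E) :
    0 < F t m s R E P := by
  unfold F
  have h1 : 0 ≤ s*(12*m - 2*t - 2) := by nlinarith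
  have h2 : 0 ≤ (2*t+1)*R := by nlinarith
  by_cases h : m ≤ t
  · nlinarith
  · have h' : t < m := not_le.mp h
    nlinarith

/-- Case II.b (L = 2, 12m < 2t+2, s ≤ 3m, P = 0 allowed): uses 4t² − 8mt + 36m² = 4(t−m)² + 32m². -/
theorem caseIIb (t m s R E P : ℤ) (ht : 1 ≤ t) (hm : 1 ≤ m) (hs : 0 ≤ s) (hs3 : s ≤ 3*m) (hR : 0 ≤ R)
    (hP : 0 ≤ P) (hsmall : 12*m < 2*t + 2) (hEt : t*(t+1) ≤ 2*E) :
    0 < F t m s R E P := by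
  unfold F
  have h1 : 3*m*(12*m - 2*t - 2) ≤ s*(12*m - 2*t - 2) := by nlinarith
  have h2 : 0 ≤ (2*t+1)*R := by nlinarith
  nlinarith [sq_nonneg (t - m), sq_nonneg m]

/-- Case III.b₁ (L ≥ 3, 12m < 2t+2, s ≤ m + R): uses (2t−m)² + 11m². -/
theorem caseIIIb1 (t m s R E P : ℤ) (ht : 1 ≤ t) (hm : 1 ≤ m) (hs : 0 ≤ s) (hsR : s ≤ m + R) (hR : 0 ≤ R)
    (hP : 0 ≤ P) (hsmall : 12*m < 2*t + 2) (hEt : t*(t+1) ≤ 2*E) :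
    0 < F t m s R E P := by
  unfold F
  -- −s·c ≥ −(m+R)·c with c = 2t+2−12m > 0, and R(2t+1) − R c = R(12m−1) ≥ 0
  have hc : 0 < 2*t + 2 - 12*m := by linarith
  have h1 : s*(12*m - 2*t - 2) ≥ (m + R)*(12*m - 2*t - 2) := by nlinarith
  have h2 : 0 ≤ R*(12*m - 1) := by nlinarith
  nlinarith [sq_nonneg (2*t - m), sq_nonneg m]

/-- Case III.b₂ (L ≥ 3, 12m < 2t+2, s > m, s > R, s ≤ 2t+1): P ≥ (s−m)(s−R); worst R = 0, then
    complete the square in s: 4F ≥ (2s − (2t+2−11m))² + [12t² + 8t + 12 + 36mt + 44m − 121m²]. -/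
theorem caseIIIb2 (t m s R E P : ℤ) (ht : 1 ≤ t) (hm : 1 ≤ m) (hsm : m < s) (hsR : R < s)
    (hs2 : s ≤ 2*t + 1) (hR : 0 ≤ R) (hP : (s - m)*(s - R) ≤ P) (hsmall : 12*m < 2*t + 2)
    (hEt : t*(t+1) ≤ 2*E) :
    0 < F t m s R E P := by
  unfold F
  have h6 : 6*m ≤ t := by linarith
  have hR' : 0 ≤ R*(2*t + 1 - s + m) := by nlinarith
  nlinarith [sq_nonneg (2*s - (2*t + 2 - 11*m)), sq_nonneg m, sq_nonneg t, mul_pos (by linarith : (0:ℤ) < t) (by linarith : (0:ℤ) < t)]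

/-- Case III.b₃ (L ≥ 3, 12m < 2t+2, s > m, s > R, s > 2t+1): P ≥ (s−m)(s−R); worst R = m + t, then
    complete the square in s: 4F ≥ (2s − (3t+2−10m))² + [15t² + 8t + 12 + 44m + 60mt − 100m²]. -/
theorem caseIIIb3 (t m s R E P : ℤ) (ht : 1 ≤ t) (hm : 1 ≤ m) (hsm : m < s) (hsR : R < s)
    (hs2 : 2*t + 1 < s) (hR : 0 ≤ R) (hRle : R ≤ m + t) (hP : (s - m)*(s - R) ≤ P)
    (hsmall : 12*m < 2*t + 2) (hEt : t*(t+1) ≤ 2*E) :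
    0 < F t m s R E P := by
  unfold F
  have h6 : 6*m ≤ t := by linarith
  -- R-coefficient (2t+1−s+m) may be negative; then R ≤ m+t is the worst case
  have hR' : (m + t)*(2*t + 1 - s + m) ≤ R*(2*t + 1 - s + m) ∨ 0 ≤ R*(2*t + 1 - s + m) := by
    by_cases h : 0 ≤ 2*t + 1 - s + m
    · right; nlinarith
    · have h' : 2*t + 1 - s + m < 0 := not_le.mp h
      left; nlinarith
  rcases hR' with h | h
  · nlinarith [sq_nonneg (2*s - (3*t + 2 - 10*m)), sq_nonneg m, sq_nonneg t]
  · nlinarith [sq_nonneg (2*s - (2*t + 2 - 11*m)), sq_nonneg m, sq_nonneg t]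

/-- MASTER (levels L ≥ 2): for every admissible (t, m, s, R, E, P) the closed bound F is positive.
    `hP3` encodes the level-≥3 product (vacuous when L = 2, where instead s ≤ 3m holds: `hL`). -/
theorem F_pos (t m s R E P : ℤ) (ht : 1 ≤ t) (hm : 1 ≤ m) (hs : 0 ≤ s) (hR : 0 ≤ R)
    (hRle : R ≤ m + t) (hP : 0 ≤ P)
    (hEt : t*(t+1) ≤ 2*E) (hEm : m*(m+1) ≤ 2*E)
    (hL : s ≤ 3*m ∨ (m < s → R < s → (s - m)*(s - R) ≤ P)) :
    0 < F t m s R E P := by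
  by_cases hbig : 2*t + 2 ≤ 12*m
  · exact caseIIa t m s R E P ht hm hs hR hP hbig hEt hEm
  have hsmall : 12*m < 2*t + 2 := not_le.mp hbig
  rcases hL with hL2 | hL3
  · exact caseIIb t m s R E P ht hm hs hL2 hR hP hsmall hEt
  by_cases h1 : s ≤ m + R
  · exact caseIIIb1 t m s R E P ht hm hs h1 hR hP hsmall hEt
  have h1' : m + R < s := not_le.mp h1
  have hsm : m < s := by linarith
  have hsR : R < s := by linarith
  have hPP := hL3 hsm hsR
  by_cases h2 : s ≤ 2*t + 1
  · exact caseIIIb2 t m s R E P ht hm hsm hsR h2 hR hPP hsmall hEt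
  · exact caseIIIb3 t m s R E P ht hm hsm hsR (not_le.mp h2) hR hRle hPP hsmall hEt

/-- The hypothesis shape: (E_soc) for N and for its Matlis dual N∨ give both bounds used above
    (e_{N∨} = e_N, μ(N∨) = t(N), t(N∨) = μ(N)); recorded as the trivial max-form. -/
theorem E_hyp_max (t m E : ℤ) (hEt : t*(t+1) ≤ 2*E) (hEm : m*(m+1) ≤ 2*E) :
    max (t*(t+1)) (m*(m+1)) ≤ 2*E := max_le hEt hEm

/-- Sanity: the extremal family of (E_soc): for N = R∕𝔪^L one has t = L, μ = 1, e_N = L(L+1)/2 — the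
    bound 2E ≥ t(t+1) is attained (numeric instance L = 7: e = 28). -/
example : (7:ℤ)*(7+1) ≤ 2*28 := by norm_num

end UnipotentESocLaw
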